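import Literature.NumberTheory.Automorphic.MirabolicEisensteinRealPoint
import Literature.NumberTheory.Automorphic.RankinSelbergQuotientUnfolding
import Literature.NumberTheory.Automorphic.WhittakerTowerParseval
import Literature.NumberTheory.Automorphic.SmoothedFormCentralCharacter
import Literature.NumberTheory.Automorphic.RankinSelbergIntegralResidue
import Literature.NumberTheory.Automorphic.SmoothedCuspFormGeneric
import HarnessLib

/-!
# The unfolding of the Rankin–Selberg integral at a real point: `I(σ; φ̄, φ, Φ) = C · Ψ(σ; W_φ, W̄_φ, Φ)`

Topic `NumberTheory/Automorphic`; namespace `Literature.NumberTheory.Automorphic`. Proof file (theorems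
only). The **basic identity of the Rankin–Selberg method** (Jacquet–Shalika (1981), §4, (4.4)–(4.6);
Cogdell (2004), §2.3, Thm. 2.1) at a REAL point `σ > 1`, for a smoothed cusp form in the honest `L²`
model and a real Schwartz–Bruhat test function `Φ ≥ 0`:

  `∫_{X} φ̄̃(x) φ̃(x) E_X(x, Φ, σ) dμ'(x) = C · Ψ(σ; W_φ, W̄_φ, Φ)`,

where `X = GL_n(K) A_G \ GL_n(𝔸_K)` with its automorphic probability measure `μ'`, `φ̃ = S_η f` (`f` in a
cuspidal automorphic representation `π`), `E_X` the descended mirabolic Eisenstein series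
(`mirabolicEisensteinQuot`), the left side the Rankin–Selberg integral `rankinSelbergIntegral μ' ν_I Φ σ φ̄̃ φ̃`
(`PairLFunctionPolesRankinSelberg`), `φ = invQuot φ̃` the classical cusp form on `GL_n(𝔸_K)`, `W_φ` its
global Whittaker coefficient, `Ψ(σ) = rankinSelbergTorusIntegral νA νK W_φ Φ σ` the unfolded integral in
torus coordinates, and `C ∈ (0, ∞)` a constant depending only on the Haar measures (not on `π`, `f`,
`η`, `Φ`, `σ`) — `exists_rankinSelbergIntegral_ofReal_eq_mul_toReal_rankinSelbergTorusIntegral`.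

Assembly of landed bricks: the real-point bridge `E(y, Φ, σ) = ∫_𝓕 w_{Φ,σ}((a 1_n) y) dν_I`
(`MirabolicEisensteinRealPoint`), the quotient unfolding `∫_X E_X F dμ' = C₁ ∫_G w β_G F(π g⁻¹) dν`
(`RankinSelbergQuotientUnfolding`, with the central character of `S_η f`, `SmoothedFormCentralCharacter`),
and the mirabolic/Whittaker unfolding with Parseval `C₃ Ψ(σ) = ∫_G |φ|² w_{Φ,σ} β_G dν`
(`WhittakerTowerParseval`).

## References

* H. Jacquet, J. A. Shalika, *On Euler products and the classification of automorphic
  representations I*, Amer. J. Math. 103 (1981), §4 [JacquetShalikaAJM1981].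
* J. W. Cogdell, *Analytic theory of L-functions for GL_n*, in *An Introduction to the Langlands
  Program* (2004), §2.3 Thm. 2.1 [CogdellAnalyticTheory2004].
-/

noncomputable section

open MeasureTheory Measure NumberField IsDedekindDomain Matrix Set Filter Topology
open scoped ENNReal NNReal ComplexConjugate

namespace Literature.NumberTheory.Automorphic

open Literature.NumberTheory.GaloisRepresentations (ideleGroup)
open Literature.MeasureTheory.Group (coveringSum IsCoveringWeight)

-- the automorphic quotient carries the tree's Borel σ-algebra, not Mathlib's quotient σ-algebra
attribute [-instance] Quotient.instMeasurableSpace QuotientGroup.measurableSpace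

section RealPoint

variable {n : ℕ} {K : Type} [Field K] [NumberField K]
variable [MeasurableSpace (AdeleRing (𝓞 K) K)] [BorelSpace (AdeleRing (𝓞 K) K)]

-- the house local instances: Borel structures of `GL_n(𝔸_K)` in both spellings (`SmoothedAutomorphicForms`,
-- `GLnIwasawaIntegration`) and of `𝔸_Kˣ` (`IdeleGroupBorel`); none overrides a Mathlib instance
attribute [local instance] adelicBorel borelSpace_adelic locallyCompactSpace_adelic secondCountableTopology_gl_adelic
  glAdeleBorel borelSpace_glAdele borelSpace_ideleGroup

/-- **The Rankin–Selberg integral at a real point unfolds to the torus integral.** There is a constant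
`C ∈ (0, ∞)`, depending only on the Haar measures, such that for every cuspidal automorphic
representation `π` of `GL_n(𝔸_K)` (`0 < n`), every `f ∈ π`, every continuous compactly supported weight
`η`, every real `Φ ≥ 0` with `Φ ∈ 𝒮(𝔸_Kⁿ)` and `g ↦ Φ(e_n g)` measurable, and every real `σ > 1`:
`I(σ; φ̄̃, φ̃, Φ) = C · Ψ(σ; W_φ, W̄_φ, Φ)` — precisely,
`rankinSelbergIntegral μ' ν_I Φ σ (star (S_η f)) (S_η f) = (C · rankinSelbergTorusIntegral νA νK W_φ Φ σ).toReal`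
with `φ = invQuot (S_η f)` and `W_φ = whittakerCoeff ν₀ 𝓕_N ψ φ` (Jacquet–Shalika (1981), §4, (4.4)–(4.6);
Cogdell (2004), Thm. 2.1). [cite: JacquetShalikaAJM1981, §4] [cite: CogdellAnalyticTheory2004, §2.3 Thm. 2.1] -/
theorem exists_rankinSelbergIntegral_ofReal_eq_mul_toReal_rankinSelbergTorusIntegral (hn : 0 < n)
    (μ' : Measure (AdelicGroupData.gl n K).automorphicQuotient) [(AdelicGroupData.gl n K).IsAutomorphicMeasure μ']
    (νI : Measure (ideleGroup K)) [νI.IsHaarMeasure]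
    (νA : Measure (Fin n → ideleGroup K)) [IsHaarMeasure νA]
    (νK : Measure ↥(maximalCompactAdelic n K)) [IsHaarMeasure νK]
    (ν₀ : Measure ↥(adelicUnipotent n K)) [IsHaarMeasure ν₀] :
    ∃ C : ℝ≥0∞, C ≠ 0 ∧ C ≠ ⊤ ∧
      ∀ (P : CuspidalAutomorphicRepGL n K μ') (f : P.1.toSubmodule)
        {η : (AdelicGroupData.gl n K).Adelic → ℝ}, Continuous η → HasCompactSupport η →
      ∀ {Φ : (Fin n → AdeleRing (𝓞 K) K) → ℝ}, (fun x => (Φ x : ℂ)) ∈ piSchwartzBruhat K (Fin n) →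
        (∀ x, 0 ≤ Φ x) → (Measurable fun g : GL (Fin n) (AdeleRing (𝓞 K) K) => Φ (lastRow n K g)) →
      ∀ {σ : ℝ}, 1 < σ →
        rankinSelbergIntegral μ' νI (fun x => (Φ x : ℂ)) (σ : ℂ)
            (star (smoothedForm η (f : (AdelicGroupData.gl n K).L2 μ')))
            (smoothedForm η (f : (AdelicGroupData.gl n K).L2 μ')) =
          ((C * rankinSelbergTorusIntegral n K νA νK
            (whittakerCoeff ν₀ (unipotentTateDomain n K) (adeleAddChar K)
              (invQuot (AdelicGroupData.gl n K) (smoothedForm η (f : (AdelicGroupData.gl n K).L2 μ'))))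
            Φ σ).toReal : ℂ) := by
  classical
  haveI : T2Space (GL (Fin n) (AdeleRing (𝓞 K) K)) := t2Space_gl n K
  haveI : LocallyCompactSpace (GL (Fin n) (AdeleRing (𝓞 K) K)) :=
    AdelicGroupData.locallyCompactSpace_generalLinearGroup_adeleRing K (Fin n)
  haveI : SecondCountableTopology (GL (Fin n) (AdeleRing (𝓞 K) K)) :=
    secondCountableTopology_generalLinearGroup_adeleRing K (Fin n)
  -- a Haar measure on `GL_n(𝔸_K)` and the two unfolding constants
  set ν : Measure (GL (Fin n) (AdeleRing (𝓞 K) K)) := Measure.haar with hν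
  haveI hνGL : IsHaarMeasure ν := by rw [hν]; infer_instance
  -- the same measure in the `(AdelicGroupData.gl n K).Adelic` spelling of `RankinSelbergQuotientUnfolding`
  haveI hνgl : (show Measure (AdelicGroupData.gl n K).Adelic from ν).IsHaarMeasure := hνGL
  obtain ⟨C₁, hC₁0, hC₁t, h5⟩ := exists_lintegral_eisensteinLIntegral_mul_eq (n := n) (K := K) hn μ' ν νI
  obtain ⟨C₃, hC₃0, hC₃t, h3⟩ :=
    exists_mul_rankinSelbergTorusIntegral_eq_lintegral_eisensteinWeight (n := n) (K := K) hn ν νA νK ν₀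
  -- an idele class domain and a `GL_n(K)`-covering weight
  obtain ⟨𝓕, h𝓕⟩ := exists_isIdeleClassDomain K
  obtain ⟨βG, hβG⟩ := exists_isCoveringWeight_ratPoints (n := n) (K := K) (⊤ : Subgroup (GL (Fin n) K))
  refine ⟨C₁ * C₃, mul_ne_zero hC₁0 hC₃0, ENNReal.mul_ne_top hC₁t hC₃t,
    fun P f {η} hη hηs {Φ} hΦS hΦ0 hΦm {σ} hσ => ?_⟩
  -- the datum
  set φt : (AdelicGroupData.gl n K).automorphicQuotient → ℂ :=
    smoothedForm η (f : (AdelicGroupData.gl n K).L2 μ') with hφt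
  set φ : GL (Fin n) (AdeleRing (𝓞 K) K) → ℂ := invQuot (AdelicGroupData.gl n K) φt with hφ
  have hφtc : Continuous φt := continuous_smoothedForm hη hηs _
  have hφc : Continuous φ := continuous_invQuot_smoothedForm hη hηs _
  have hφK : ∀ (γ₀ : GL (Fin n) K) (x : GL (Fin n) (AdeleRing (𝓞 K) K)),
      φ (Matrix.GeneralLinearGroup.map (algebraMap K (AdeleRing (𝓞 K) K)) γ₀ * x) = φ x :=
    fun γ₀ x => isLeftInvariant_invQuot _ φt _ ⟨γ₀, rfl⟩ x
  have hcusp : ∀ k, 0 < k → k < n → CuspConditionGL n K φ k := fun k hk hkn =>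
    cuspConditionGL_invQuot_smoothedForm hη hηs (P.2.1 f.2) hk hkn
  have hΦc : Continuous Φ := by
    have h : Continuous fun x => ((Φ x : ℂ)).re := Complex.continuous_re.comp (continuous_of_mem_piSchwartzBruhat hΦS)
    simpa only [Complex.ofReal_re] using h
  -- the Eisenstein weight and its idele-class integral
  set W : GL (Fin n) (AdeleRing (𝓞 K) K) → ℝ≥0∞ := eisensteinWeight n K Φ σ with hW
  have hWm : Measurable W := measurable_eisensteinWeight
    (fun v => (hΦc.comp (continuous_const.matrix_vecMul Units.continuous_val)).measurable) σ
  have hWK : ∀ (γ : GL (Fin n) K) (g : GL (Fin n) (AdeleRing (𝓞 K) K)),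
      W (Matrix.GeneralLinearGroup.map (algebraMap K (AdeleRing (𝓞 K) K)) γ * g) = W g :=
    fun γ g => eisensteinWeight_map_mul Φ σ γ g
  -- the descended Eisenstein series is real, non-negative and given by the idele-class integral
  set E : (AdelicGroupData.gl n K).automorphicQuotient → ℂ :=
    mirabolicEisensteinQuot νI (fun x => (Φ x : ℂ)) (σ : ℂ) with hE
  have hσ' : 1 < ((σ : ℂ)).re := by rwa [Complex.ofReal_re]
  have hEc : Continuous E := continuous_mirabolicEisensteinQuot_of_mem_piSchwartzBruhat K νI hΦS hσ'
  set EX : (AdelicGroupData.gl n K).automorphicQuotient → ℝ≥0∞ := fun x => ENNReal.ofReal (E x).re with hEX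
  have hEXm : Measurable EX := ENNReal.measurable_ofReal.comp (Complex.continuous_re.comp hEc).measurable
  have hEg : ∀ g : GL (Fin n) (AdeleRing (𝓞 K) K),
      (∫⁻ a in 𝓕, W (Matrix.GeneralLinearGroup.scalar (Fin n) a * g⁻¹) ∂νI) < ⊤ ∧
      E ((AdelicGroupData.gl n K).toAutomorphicQuotient g) =
        ((∫⁻ a in 𝓕, W (Matrix.GeneralLinearGroup.scalar (Fin n) a * g⁻¹) ∂νI).toReal : ℂ) := by
    intro g
    rw [hE, mirabolicEisensteinQuot_toAutomorphicQuotient]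
    exact mirabolicEisenstein_ofReal_eq_toReal_setLIntegral_eisensteinWeight νI h𝓕 hΦS hΦ0 hσ g⁻¹
  have hEXg : ∀ g : GL (Fin n) (AdeleRing (𝓞 K) K), EX ((AdelicGroupData.gl n K).toAutomorphicQuotient g) =
      ∫⁻ a in 𝓕, W (Matrix.GeneralLinearGroup.scalar (Fin n) a * g⁻¹) ∂νI := by
    intro g
    rw [hEX]
    simp only []
    rw [(hEg g).2, Complex.ofReal_re, ENNReal.ofReal_toReal (hEg g).1.ne]
  have hEre : ∀ x, E x = (((EX x).toReal : ℝ) : ℂ) := by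
    intro x
    obtain ⟨g, rfl⟩ := (AdelicGroupData.gl n K).toAutomorphicQuotient_surjective x
    rw [hEXg, (hEg g).2]
  -- `F = |φ̃|²` and its central invariance
  set F : (AdelicGroupData.gl n K).automorphicQuotient → ℝ≥0∞ := fun x => ENNReal.ofReal (‖φt x‖ ^ 2) with hF
  have hFm : Measurable F := ENNReal.measurable_ofReal.comp (hφtc.norm.pow 2).measurable
  obtain ⟨ω, -, -, -, -, hnorm, -⟩ := P.exists_centralCharacter_smoothedForm
  have hFZ : ∀ (z : ideleGroup K) (g : GL (Fin n) (AdeleRing (𝓞 K) K)),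
      F ((AdelicGroupData.gl n K).toAutomorphicQuotient (Matrix.GeneralLinearGroup.scalar (Fin n) z * g)) =
        F ((AdelicGroupData.gl n K).toAutomorphicQuotient g) := by
    intro z g
    simp only [hF, hφt, hnorm η f z g]
  -- Step 1: the Rankin–Selberg integral as a `[0, ∞]` integral on the quotient
  have hRS : rankinSelbergIntegral μ' νI (fun x => (Φ x : ℂ)) (σ : ℂ) (star φt) φt =
      ((∫⁻ x, EX x * F x ∂μ').toReal : ℂ) := by
    unfold rankinSelbergIntegral
    have hint : ∀ x, (star φt) x * φt x * mirabolicEisensteinQuot νI (fun x => (Φ x : ℂ)) (σ : ℂ) x =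
        ((‖φt x‖ ^ 2 * (EX x).toReal : ℝ) : ℂ) := by
      intro x
      rw [← hE, hEre x, Pi.star_apply, Complex.star_def, Complex.conj_mul', Complex.ofReal_mul]
      push_cast
      ring
    simp_rw [hint]
    have h0 : ∀ x, 0 ≤ ‖φt x‖ ^ 2 * (EX x).toReal := fun x => mul_nonneg (sq_nonneg _) ENNReal.toReal_nonneg
    have hm : AEStronglyMeasurable (fun x => ‖φt x‖ ^ 2 * (EX x).toReal) μ' :=
      ((hφtc.norm.pow 2).measurable.mul hEXm.ennreal_toReal).aestronglyMeasurable
    rw [show (∫ x, (((‖φt x‖ ^ 2 * (EX x).toReal : ℝ)) : ℂ) ∂μ') = ((∫ x, ‖φt x‖ ^ 2 * (EX x).toReal ∂μ' : ℝ) : ℂ)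
      from integral_ofReal, integral_eq_lintegral_of_nonneg_ae (Eventually.of_forall h0) hm]
    congr 2
    refine lintegral_congr fun x => ?_
    rw [ENNReal.ofReal_mul (sq_nonneg _), ENNReal.ofReal_toReal ENNReal.ofReal_ne_top, mul_comm]
  -- Step 2: unfold on the quotient, Step 3: unfold to the torus
  have h5' := h5 h𝓕 hWm hWK hFm hFZ hEXm hEXg hβG.1 hβG.2
  have h3' := h3 hφc hφK hcusp hΦ0 hΦm σ hβG.1 hβG.2
  -- the group-side integrals agree (stated in the `(AdelicGroupData.gl n K).Adelic` spelling of `h5'`)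
  have hG : (∫⁻ g : (AdelicGroupData.gl n K).Adelic,
      W g * βG g * F ((AdelicGroupData.gl n K).toAutomorphicQuotient g⁻¹)
        ∂(ν : Measure (AdelicGroupData.gl n K).Adelic)) =
      C₃ * rankinSelbergTorusIntegral n K νA νK
        (whittakerCoeff ν₀ (unipotentTateDomain n K) (adeleAddChar K) φ) Φ σ := by
    rw [h3']
    show (∫⁻ x : GL (Fin n) (AdeleRing (𝓞 K) K),
      W x * βG x * F ((AdelicGroupData.gl n K).toAutomorphicQuotient x⁻¹) ∂ν) = _
    refine lintegral_congr fun g => ?_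
    simp only [hF, hW, hφ, invQuot_apply]
    ring
  rw [hRS, h5']
  exact congrArg (fun t : ℝ≥0∞ => ((t.toReal : ℝ) : ℂ))
    ((congrArg (fun t => C₁ * t) hG).trans (mul_assoc _ _ _).symm)

end RealPoint

end Literature.NumberTheory.Automorphic
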